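import Summits.Schanuel.Schanuel.Theorems.RootDecomp1KTrinomialDescent03

/-!
# RootDecomp1KTrinomialDescent — lens 1, generation 64, NODE 25 «TRINOMIAL (FERMAT-QUOTIENT) DESCENT ON THE K-LINE — the curve X3 decided: EMPTY AT EVERY LEVEL» (×0-as-record under RULE K-R51 (i): for every trinomial σ₀Y^d + σ₁2^s·x^i·Y^k + σ₂x^j with Δ = (d−k)(j−i) − i·k odd ≥ 3 and primitive inner edges — the class FermatTri — NO rational point over any dyadic x = p/2^n, p odd, |p| ≠ 1, n ≥ 1, hence no level point for N ≥ 2 ⇒ LevelFinite / ThinFibreAt ∀ m₀ / BddLevelEmpty; X3 = x³ + Y·x + Y⁷ EMPTY at every level N ≥ 0; elementary: unique factorisation + parity; CLAIM L2956, PRICE L2959 (β), ERRATUM E3, RULE K-R56) — continuation (RootDecomp1KTrinomialDescent04): §F the term of record X3P (bev_X3P, fermatTri_X3P, no_level_X3P, levelSet_X3P_eq_empty, levelFinite_X3P, thinFibreAt_X3P, bddLevelEmpty_X3P) and the family FT (section Witness)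

(lens-1 g64 NODE 25 «TRINOMIAL (FERMAT-QUOTIENT) DESCENT ON THE K-LINE — the curve X3 decided: EMPTY AT EVERY LEVEL» L2968: HOME kernel K = HOME/decomp-schanuel-lens-1/g64/lean/TrinomialDescent.lean sha256 e7961d57…, 1095 l, 95 decls, ONE namespace `Summit.Schanuel.Schanuel.Theorems.RootDecomp1KTrinomialDescent`, imports the tree port …RootDecomp1KSuperellipticSiegel06 ONLY; no private, no instance, no set_option, no notation, no sorry, no decide; lens farm: K rc 0 · 0 errors · 0 sorries, Probe rc 0 (155 `#print axioms` guards ⊆ the standard triple), Ctrl0 rc 0, Ctrl rc 1 = 35 planted errors exactly; CLAIM L2956 (ASK-FIRST under K-R55 (iii)); crit g12 PRICE L2959: RULING (β) ×0-AS-RECORD under RULE K-R51 (i) (descent lane: Chevalley–Weil along the étale μ₁₁-torsor defined by the ℚ-rational cuspidal 11-torsion of J_X3 + an elementary step upstairs) — «BUILD, ×0 VERDICT and RECORD PORT WELCOME AND REQUESTED»; ERRATUM E3 (critic's: X3 is NOT open territory — STRUCK as standing witness); RULE K-R56 PRE-ANNOUNCED; CHECKLIST K-g64 (1)–(9); census LIVENESS-v31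 (keys tri / cusp / jac of record L2969: FermatTri YES on X3 only, cuspidal group of order 11, census kit jac: #J_X3(𝔽_p) for p = 5, 13, 23 has gcd exactly 11); writer g34 NOTE 4 L2960 (pre-check 15/15 + 5/5); critic VERDICT: VERIFIED, OF RECORD: ×0-AS-RECORD under RULE K-R51 (i) (the descent lane; no credit class), VERDICT L2971 (crit-1 g12, 2026-09-02T00:18Z): CHECKLIST K-g64 (1)–(9) met item by item on the critic's own farm runs (K rc 0 · 0 errors · 0 sorries; Probe rc 0 with 155 `#print axioms` closures ⊆ the standard triple; Ctrl0 rc 0; Ctrl rc 1 = exactly the 35 planted errors; Pin25.lean 25/25); tally of record UNCHANGED lens-1 ×21 + THEOREM ×23; ERRATUM E3 FINAL (X3 = x³ + Y·x + Y⁷ STRUCK as standing witness: J_X3(ℚ)[11] ∋ [P₁ − P_∞] cuspidal; census jac gcd = 11 at p = 5, 13, 23); RULE K-R56 FIXED (+ the (d2) precision and GLOSS); PORT GO L2973 (×0 RECORD port, census-1; `--supports stmt-Schanuel-33364`, the item stays OPEN). Port by census-1 gen 24 as `RootDecomp1KTrinomialDescent01–05` (`--supports stmt-Schanuel-33364`;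 the item stays OPEN; ×0 record port, no credit anywhere): 01 = §A arithmetic part 1 (section Arithmetic: L1 parity lemmas `odd_geom_sum₂` / `le_geom_sum₂` / `pow_ne_pow_add_two_pow` / `eq_one_of_pow_add_pow_eq_two_pow` / `pow_ne_pow_add_two_pow_both`, valuations, perfect powers; section Arithmetic closed at the cut); 02 = §A part 2 (section Arithmetic re-opened: section Core — `perPrime`, `trinomial_core`); 03 = §B the term `triP` and the class `def FermatTri` (section Trinomial) + §C (M1) the 2-adic descent `den_of_root_triP` / `bev_triP_ne_zero_of_dyadic` (section TwoAdic) + §D the K-line doors `no_level_of_fermatTri` / `levelFinite_of_fermatTri` / `thinFibreAt_of_fermatTri` / `bddLevelEmpty_of_fermatTri` (section KLine); 04 = §F the term of record `X3P` (`bev_X3P`, `fermatTri_X3P`, `no_level_X3P`, `levelSet_X3P_eq_empty`, `levelFinite_X3P`, `thinFibreAt_X3P`, `bddLevelEmpty_X3P`) and the family `FT` (section Witness); 05 = §T territory refusals by tree names (`xdeg_X3P`, `not_domSuper_X3P`, `not_domHyper_X3P`, `den_of_level_X3P`, the class boundary `not_fermatTri_of_two_coeffs`, the nominee `X5P` typed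 as a NON-member) (section Territory) + §N sharpness (section Sharpness). Text = K VERBATIM (every declaration documented by the lens; statements and proofs unchanged; K's module docstring kept in part 01 below this provenance block).)
-/

noncomputable section

namespace Summit.Schanuel.Schanuel.Theorems.RootDecomp1KTrinomialDescent

open Polynomial Finset
open LiouvilleNumber
open scoped Nat
open Summit.Schanuel.Schanuel.Theorems.RootDecomp1KDegreeLadder
open Summit.Schanuel.Schanuel.Theorems.RootDecomp1KXTop
open Summit.Schanuel.Schanuel.Theorems.RootDecomp1KXAll
open Summit.Schanuel.Schanuel.Theorems.RootDecomp1KLevelFinite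
open Summit.Schanuel.Schanuel.Theorems.RootDecomp1KHeightGrading (BddLevelEmpty bddLevelEmpty_iff_levelFinite H17P h17C
  h17C_one)
open Summit.Schanuel.Schanuel.Theorems.RootDecomp1KOddEmpty (levelFinite_of_no_level W4P w4C)
open Summit.Schanuel.Schanuel.Theorems.RootDecomp1KTwoBaseCell (psNumer partialSum_eq_psNumer_div coprime_psNumer)
open Summit.Schanuel.Schanuel.Theorems.RootDecomp1KRelLiouvilleCell (partialSum_two_zero)
open Summit.Schanuel.Schanuel.Theorems.RootDecomp1KRunge (psNumer_pos_runge RW rwC rwC_four)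
open Summit.Schanuel.Schanuel.Theorems.RootDecomp1KSuperellipticSiegel (DomSuper exists_root_septic T tC A xCoeff_T
  tC_zero coeff_A_seven coeff_A_zero twoTermC twoTermP_eq_xPolyP)
open Summit.Schanuel.Schanuel.Theorems.RootDecomp1KHyperellipticSiegel (DomHyper)

/-! ## §F  THE STANDING WITNESS `X3 = x³ + Y·x + Y⁷` AND THE FAMILY `FT m l = Y^(m+1) + x·Y + x^(l+1)` -/

section Witness

/-- the node-24 coefficient vector of `X3` (Probe term of record, verbatim): `c₃ = 1`, `c₁ = Y`, `c₀ = Y⁷`. -/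
def x3C : ℕ → ℤ[X] := fun i => if i = 3 then 1 else if i = 1 then X else if i = 0 then X ^ 7 else 0

/-- [term] **`X3P = x³ + Y·x + Y⁷`** — the FIRST tree name of the curve `X3` (node 24's Probe / Ctrl0 spoke of the term
`xPolyP 3 [Y⁷, Y, 0, 1]` only): dominant-far, NON-LACUNARY, `xdeg 3`, genus 5; standing witness of K-R55 (ii) of record
until ERRATUM E3 (PRICE L2959) — decided EMPTY at every level below. -/
def X3P : ℤ[X][X] := xPolyP 3 x3C

/-- `: x3C 0 = X ^ 7`. -/
@[simp] theorem x3C_zero : x3C 0 = X ^ 7 := by simp [x3C]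
/-- `: x3C 1 = X`. -/
@[simp] theorem x3C_one : x3C 1 = X := by simp [x3C]
/-- `: x3C 2 = 0`. -/
@[simp] theorem x3C_two : x3C 2 = 0 := by simp [x3C]
/-- `: x3C 3 = 1`. -/
@[simp] theorem x3C_three : x3C 3 = 1 := by simp [x3C]

/-- `(x y : ℝ) : bev X3P x y = x ^ 3 + x * y + y ^ 7`. -/
@[simp] theorem bev_X3P (x y : ℝ) : bev X3P x y = x ^ 3 + x * y + y ^ 7 := by
  have h : bev X3P x y = y ^ 7 + x * y + x ^ 3 := by simp [X3P, Finset.sum_range_succ]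
  rw [h]; ring

/-- `X3P` IS the trinomial `triP 1 1 1 6 1 1 2` (`(m,i,k,l) = (6,1,1,2)`, `a = 1·2⁰`: `Y⁷ + x·Y + x³`). -/
theorem X3P_eq_triP : X3P = triP 1 1 1 6 1 1 2 := by
  simp only [X3P, xPolyP, triP, Finset.sum_range_succ, Finset.sum_range_zero, x3C_zero, x3C_one, x3C_two,
    x3C_three]
  simp

/-- **`X3P ∈ FermatTri`** with `Δ = 2·6 − 1·1 = 11`. -/
theorem fermatTri_X3P : FermatTri X3P := by
  have h := fermatTri_triP (Or.inl rfl) (Or.inl rfl) (Or.inl rfl) (s := 0) (m := 6) (l := 2) (Δ := 11) one_pos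
    one_pos (by norm_num) (by norm_num) (by norm_num) (Nat.coprime_one_right 6) (Nat.coprime_one_left 2)
  rw [pow_zero, mul_one] at h
  rwa [X3P_eq_triP]

/-- level `N = 1` (`s_1 = 1`): `r⁷ + r + 1 ≠ 0` over `ℚ` (clear denominators, then parity). -/
theorem bev_X3P_one_ne_zero (r : ℚ) : bev X3P 1 r ≠ 0 := by
  rw [bev_X3P, one_pow, one_mul]
  intro h
  have hq : (r : ℚ) ^ 7 + r + 1 = 0 := by
    have h' : ((r : ℚ) : ℝ) ^ 7 + ((r : ℚ) : ℝ) + 1 = 0 := by linarith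
    exact_mod_cast h'
  have key : ((r.num ^ 7 + r.num * (r.den : ℤ) ^ 6 + (r.den : ℤ) ^ 7 : ℤ) : ℚ) = (r.den : ℚ) ^ 7 * (r ^ 7 + r + 1) := by
    push_cast
    rw [← Rat.mul_den_eq_num r]
    ring
  rw [hq, mul_zero] at key
  have hZ : r.num ^ 7 + r.num * (r.den : ℤ) ^ 6 + (r.den : ℤ) ^ 7 = 0 := by exact_mod_cast key
  have hdvd : (r.den : ℤ) ∣ r.num ^ 7 := by
    have e : r.num ^ 7 = (r.den : ℤ) * (-(r.num * (r.den : ℤ) ^ 5 + (r.den : ℤ) ^ 6)) := by linear_combination hZ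
    exact ⟨_, e⟩
  have hv1 : r.den = 1 := by
    have h' : r.den ∣ r.num.natAbs ^ 7 := by
      have := Int.natCast_dvd.mp hdvd; rwa [Int.natAbs_pow] at this
    exact Nat.Coprime.eq_one_of_dvd (r.reduced.symm.pow_right 7) h'
  simp only [hv1, Nat.cast_one, one_pow, mul_one] at hZ
  rcases Int.even_or_odd r.num with hu | hu
  · have hodd : Odd (r.num ^ 7 + r.num + 1) := ((hu.pow_of_ne_zero (by norm_num)).add hu).add_odd odd_one
    rw [hZ] at hodd; have := Int.odd_iff.mp hodd; omega
  · have hodd : Odd (r.num ^ 7 + r.num + 1) := (hu.pow.add_odd hu).add_odd odd_one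
    rw [hZ] at hodd; have := Int.odd_iff.mp hodd; omega

/-- level `N = 0` (`s_0 = 1/2`): the 2-adic far segment would need `3 = 7·e`. -/
theorem bev_X3P_zero_ne_zero (r : ℚ) : bev X3P (partialSum 2 0) r ≠ 0 := by
  intro h
  rw [partialSum_two_zero, X3P_eq_triP, show (1 : ℝ) / 2 = ((1 : ℤ) : ℝ) / 2 ^ 1 by norm_num,
    show triP 1 1 1 6 1 1 2 = triP 1 (1 * 2 ^ 0) 1 6 1 1 2 by rw [pow_zero, mul_one]] at h
  obtain ⟨e, -, -, hw⟩ := den_eq_two_pow_of_root_triP (Or.inl rfl) (Or.inl rfl) (Or.inl rfl) (Δ := 11) one_pos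
    one_pos (by norm_num) (by norm_num) odd_one le_rfl h
  omega

/-- **THE STANDING WITNESS DECIDED: `X3` HAS NO RATIONAL POINT AT ANY LEVEL OF THE K-LINE.** -/
theorem no_level_X3P (N : ℕ) (r : ℚ) : bev X3P (partialSum 2 N) r ≠ 0 := by
  rcases Nat.lt_or_ge N 2 with hN | hN
  · interval_cases N
    · exact bev_X3P_zero_ne_zero r
    · have e : partialSum 2 1 = 1 := by simp [partialSum, Finset.sum_range_succ]; norm_num
      rw [e]; exact bev_X3P_one_ne_zero r
  · exact no_level_of_fermatTri fermatTri_X3P hN r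

/-- every level set of `X3` is EMPTY. -/
theorem levelSet_X3P_eq_empty (C : ℝ) : LevelSet X3P C = ∅ :=
  Set.eq_empty_of_forall_notMem fun N ⟨r, _, hroot, _⟩ => no_level_X3P N r hroot

/-- **`LevelFinite X3P`** — hypothesis-free. -/
theorem levelFinite_X3P : LevelFinite X3P := levelFinite_of_no_level no_level_X3P

/-- **`ThinFibreAt m₀ X3P` for EVERY `m₀`** (the K-line's `m₀ = 2` included) — hypothesis-free. -/
theorem thinFibreAt_X3P (m₀ : ℕ) : ThinFibreAt m₀ X3P := thinFibreAt_of_levelFinite levelFinite_X3P m₀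

/-- **`BddLevelEmpty X3P`** — hypothesis-free. -/
theorem bddLevelEmpty_X3P : BddLevelEmpty X3P := (bddLevelEmpty_iff_levelFinite X3P).mpr levelFinite_X3P

/-- **the 2-adic FAR SEGMENT of `X3`, typed** (census «v(r) = −3/7·L»): over a dyadic abscissa `p/2^n` (`p` odd, `n ≥ 1`)
a rational root has `den r = 2^e` with `3·n = 7·e`, `e ≥ 1` — CONTENTFUL for the class (members with `|p| = 1` DO carry
such points, §N); the odd part of the theorem is what empties `X3`. -/
theorem den_of_root_X3P {p : ℤ} (hp : Odd p) {n : ℕ} (hn : 1 ≤ n) {r : ℚ}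
    (h : bev X3P ((p : ℝ) / 2 ^ n) r = 0) : ∃ e : ℕ, r.den = 2 ^ e ∧ 1 ≤ e ∧ 3 * n = 7 * e := by
  rw [X3P_eq_triP, show triP 1 1 1 6 1 1 2 = triP 1 (1 * 2 ^ 0) 1 6 1 1 2 by rw [pow_zero, mul_one]] at h
  obtain ⟨e, hv, he, hw⟩ := den_eq_two_pow_of_root_triP (Or.inl rfl) (Or.inl rfl) (Or.inl rfl) (Δ := 11) one_pos
    one_pos (by norm_num) (by norm_num) hp hn h
  exact ⟨e, hv, he, by omega⟩

/-- … at the levels of the K-line (PRICE K-g64 (5) verbatim): `X3(s_N, r) = 0 → 7 ∣ N! ∧ den r = 2^(3·N!/7)` — with the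
rider of record that NO such `r` exists (`no_level_X3P`), from which it follows outright. -/
theorem den_of_level_X3P {N : ℕ} {r : ℚ} (h : bev X3P (partialSum 2 N) r = 0) :
    7 ∣ N ! ∧ r.den = 2 ^ (3 * N ! / 7) :=
  absurd h (no_level_X3P N r)

/-- **REAL LIVENESS** at every real abscissa (odd `Y`-degree; the tree's `exists_root_septic` BY NAME): the emptiness of
the levels of `X3` is ARITHMETIC, not real. -/
theorem exists_real_root_X3P (x : ℝ) : ∃ y : ℝ, bev X3P x y = 0 := by
  obtain ⟨y, hy⟩ := exists_root_septic x (x ^ 3)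
  exact ⟨y, by rw [bev_X3P]; linear_combination hy⟩

/-- … in particular at every level `s_N`. -/
theorem X3P_real_live (N : ℕ) : ∃ y : ℝ, bev X3P (partialSum 2 N) y = 0 := exists_real_root_X3P _

/-- every fibre `Y = r` of `X3` is NON-DEGENERATE (`X3(1, r) ≠ 0`): the level sets are empty for want of ROOTS. -/
theorem X3P_nondegenerate (r : ℚ) : ∃ x : ℝ, bev X3P x (r : ℝ) ≠ 0 := ⟨1, bev_X3P_one_ne_zero r⟩

/-- **the family `FT m l = Y^(m+1) + x·Y + x^(l+1)`** (`X3P = FT 6 2`). -/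
def FT (m l : ℕ) : ℤ[X][X] := triP 1 1 1 m 1 1 l

/-- `: X3P = FT 6 2`. -/
theorem X3P_eq_FT : X3P = FT 6 2 := X3P_eq_triP

/-- `(m l : ℕ) (x y : ℝ) : bev (FT m l) x y = y ^ (m + 1) + x * y + x ^ (l + 1)`. -/
@[simp] theorem bev_FT (m l : ℕ) (x y : ℝ) : bev (FT m l) x y = y ^ (m + 1) + x * y + x ^ (l + 1) := by
  simp [FT]

/-- `FT m l ∈ FermatTri` as soon as `l·m` is EVEN and `≥ 4` (`Δ = l·m − 1` odd `≥ 3`; the edges `(m,1)`, `(1,l)` are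
primitive): e.g. `Y^d + x·Y + x³` for every `d ≥ 3`, `Y^7 + x·Y + x^j` for every `j ≥ 2` with `j` odd or … -/
theorem fermatTri_FT {m l : ℕ} (he : Even (l * m)) (h4 : 4 ≤ l * m) : FermatTri (FT m l) := by
  have h := fermatTri_triP (Or.inl rfl) (Or.inl rfl) (Or.inl rfl) (s := 0) (m := m) (l := l) (Δ := l * m - 1)
    one_pos one_pos (by omega) (Nat.Even.sub_odd (by omega) he odd_one) (by omega) (Nat.coprime_one_right m)
    (Nat.coprime_one_left l)
  rwa [pow_zero, mul_one] at h

/-- the PRICE's box in total-degree letters `d = m + 1`, `j = l + 1` (`FT (d−1) (j−1) = Y^d + x·Y + x^j`): `3 ≤ d`,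
`3 ≤ j`, `(d−1)·(j−1)` even (`Δ = (d−1)(j−1) − 1`). -/
theorem fermatTri_FT_deg {d j : ℕ} (hd : 3 ≤ d) (hj : 3 ≤ j) (he : Even ((d - 1) * (j - 1))) :
    FermatTri (FT (d - 1) (j - 1)) :=
  fermatTri_FT (by rwa [mul_comm] at he)
    (le_trans (by norm_num) (Nat.mul_le_mul (show 2 ≤ j - 1 by omega) (show 2 ≤ d - 1 by omega)))

/-- `{m l : ℕ} (he : Even (l * m)) (h4 : 4 ≤ l * m) {N : ℕ} (hN : 2 ≤ N) (r : ℚ) : bev (FT m l) (partialSum 2 N) r ≠ 0`. -/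
theorem no_level_FT {m l : ℕ} (he : Even (l * m)) (h4 : 4 ≤ l * m) {N : ℕ} (hN : 2 ≤ N) (r : ℚ) :
    bev (FT m l) (partialSum 2 N) r ≠ 0 :=
  no_level_of_fermatTri (fermatTri_FT he h4) hN r

/-- `{m l : ℕ} (he : Even (l * m)) (h4 : 4 ≤ l * m) : LevelFinite (FT m l)`. -/
theorem levelFinite_FT {m l : ℕ} (he : Even (l * m)) (h4 : 4 ≤ l * m) : LevelFinite (FT m l) :=
  levelFinite_of_fermatTri (fermatTri_FT he h4)

/-- `{m l : ℕ} (he : Even (l * m)) (h4 : 4 ≤ l * m) (m₀ : ℕ) : ThinFibreAt m₀ (FT m l)`. -/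
theorem thinFibreAt_FT {m l : ℕ} (he : Even (l * m)) (h4 : 4 ≤ l * m) (m₀ : ℕ) : ThinFibreAt m₀ (FT m l) :=
  thinFibreAt_of_fermatTri (fermatTri_FT he h4) m₀

/-- `{m l : ℕ} (he : Even (l * m)) (h4 : 4 ≤ l * m) : BddLevelEmpty (FT m l)`. -/
theorem bddLevelEmpty_FT {m l : ℕ} (he : Even (l * m)) (h4 : 4 ≤ l * m) : BddLevelEmpty (FT m l) :=
  bddLevelEmpty_of_fermatTri (fermatTri_FT he h4)

end Witness

end Summit.Schanuel.Schanuel.Theorems.RootDecomp1KTrinomialDescent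

end
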